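/- Copyright: the b2b-balaban cell (near-miss cell 7), T⁴-continuum fan-out, lineage t4-ne7b-p1 (node U5c COUNT
member).  Released under the licence of the surrounding project. -/
import Summits.QuantumFields.BalabanUV.T4Continuum.Support.HistoryGenealogyDissolveSplice
import Summits.QuantumFields.BalabanUV.T4Continuum.Support.HistoryGenealogyInstantiateMClauses

/-!
# DISSOLVING THE FRESH CLUSTERS (junction M4, pass V, part 2c — last steps, last-event domains, and the memory
shift): the extracted genealogy of a REAL component in the dissolved bookkeeping has EITHER the same last step and
last-event domain as in print's bookkeeping, OR — exactly for the lines descending from a fresh cluster's first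
continuation by lone unrenewed steps (the «V-lines») — last step ONE LATER and last-event domain ONE `S`-STEP ON; and
a frozen-memory stop read from the later event is a current-memory stop read from print's event when the memory one
step on is dominated by the next level's frozen memory (owner module of row NE7b, lineage `t4-ne7b-p1` gen 42; ruling
R-OWNER-42-1 «pass V supersedes pass T» = R-OWNER-22-7 (α) at the junction; re-open object (α), `SCOPE-alpha.md` v2.3
§5 row M4, located open point G-M4-1 — PRE-POSITIONING ONLY)

Summits-side support leaf of the T⁴-continuum cell (rung (B)+1 on a FINITE torus only; NOT infinite volume, NOT the
mass gap, NOT the Clay statement; NOT a proof of the spine estimate NE7b, which is the cell's OWN estimate, NOT PRINTED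
and NOT PROVED).  [folklore] finite combinatorics and index-model geometry over parts 1a∕1b∕2a∕2b (`dissolve`,
`Fresh`, `pseudo`, `partV`, `splice`, `SpliceOK`, `LabelOK`), rows S13-R∕S14-R (`pgenR`, `assembleR`, `edomR`,
`lonePartR`), row S1b (`orbit`, `Stops`, `CondI`), leaf-01's memory kit (`StopsM`), the Literature stopping rule
(`B16StoppingRule.StopAt`∕`CondII`) and S-profile (`Sop`, `ratio`); nothing printed is asserted, no `def … : Prop`
fact of Bałaban's, no cite-tagged hypothesis, zero `sorry`.  B16 = [Balaban1989LargeFieldII] pp. 384–386, B15 =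
[Balaban1989LargeFieldI] p. 177 are manuscripts UNDER AUDIT; locators only.

WHAT.  §1 **the memory shift**: `orbit_succ_Sop` (the orbit from `t + 1` of the first image is the orbit from `t`,
one index on), **`stopsM_of_stops_succ`** (`Rm t (k+1) ≤ R (t+1)` ⟹ a frozen stop at `(t+1, S E, k)` is an `Rm`-stop
at `(t, E, k+1)` — condition (ii)'s inspected scales shift by one and shrink), `two_le_of_stopsM` (no `Rm`-readiness at
the relative index `1` when `2 ≤ Rm t 1`); §2 the genealogy of a PSEUDO-component is the lone birth of its region
(`pgenR_dissolve_pseudo`, `edomR_dissolve_pseudo`), a fresh cluster's genealogy has its last event at its own level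
with last-event domain its domain (`lastStep_pgenR_fresh`, `edomR_fresh`); §3 **`lastStep_edomR_dissolve`** — THE
DICHOTOMY for every real non-fresh component (induction on the level through print's five cases: lone unflagged
non-fresh part — inherited; lone flagged part, lone birth, ≥ 2 constituents — events on both sides, equal; lone FRESH
part — the virtual merger: `lastStep⁺ = lastStep + 1 ≤ level`, `edom⁺ = S(edom)` by (G-flow)).
Part 3 (`…JunctionV`) feeds these to the process `RunInputM.histM`: the END's pendency and readiness clauses for the
V-lines follow from the process's `Rm`-facts by §1, for the other lines verbatim.

HONEST.  Proves nothing of Bałaban's; a re-indexing of OUR bookkeeping; by-name class of every `WALL-NE7b-P1.md` §2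
binder UNCHANGED; NE7b NOT proved; spine 0∕9.  HONEST DEPENDENCY (cell): continuum YM on T⁴ ⇐ BetaPertH ∧ nine spine
estimates (0/9 proved); BetaPertH ⇐ (D1) ∧ (D4) ∧ CAP+tail; G-an2-4 gates asym, D1 and NE2/3/4.  This file changes none
of it. -/

open Finset
open Literature.MathematicalPhysics.QuantumFieldTheory.Balaban1983to89
open Literature.MathematicalPhysics.QuantumFieldTheory.Balaban1983to89.B13ScaleTransfer
open Literature.MathematicalPhysics.QuantumFieldTheory.Balaban1983to89.B16SProfile
open Literature.MathematicalPhysics.QuantumFieldTheory.Balaban1983to89.B16StoppingRule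
open Literature.MathematicalPhysics.QuantumFieldTheory.Balaban1983to89.B16MergeGeometry
open Summit.QuantumFields.BalabanUV.T4Continuum.HistoryAdmissible
open Summit.QuantumFields.BalabanUV.T4Continuum.HistoryRealise
open Summit.QuantumFields.BalabanUV.T4Continuum.HistoryRealiseMemory
open Summit.QuantumFields.BalabanUV.T4Continuum.HistoryGenealogyExtraction
open Summit.QuantumFields.BalabanUV.T4Continuum.HistoryGenealogyRealise
open Summit.QuantumFields.BalabanUV.T4Continuum.HistoryGenealogyRealise.GeomHistoryR
open Summit.QuantumFields.BalabanUV.T4Continuum.HistoryGenealogyInstantiate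

namespace Summit.QuantumFields.BalabanUV.T4Continuum.HistoryGenealogyExtraction

noncomputable section

open Classical

variable {d : ℕ}

/-! ## §1 The memory shift: frozen stops one event later are current stops from print's event -/

section Shift

variable (L : ℕ) (s : ℕ → ℕ)

/-- the orbit from `t + 1` of the first image is the orbit from `t`, one index on [folklore] -/
theorem orbit_succ_Sop (t : ℕ) (E : Finset (Pt d)) (l : ℕ) :
    orbit L s (t + 1) (Sop (ratio L s t) E) l = orbit L s t E (l + 1) := by
  rw [Nat.add_comm l 1, orbit_add L s t E 1 l]
  rfl

variable {L s}

/-- **THE MEMORY SHIFT.**  If the memory demanded at `(t, k+1)` is at most the frozen memory of level `t + 1`, then a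
FROZEN stop of the first image, formed at `t + 1`, at the relative index `k` is an `Rm`-stop of the domain formed at
`t` at the relative index `k + 1` (same scale; condition (ii) inspects the scales `k − N + 1 … k` of the later orbit =
`k − N + 2 … k + 1` of the earlier one, fewer than the `k + 2 − Rm … k + 1` demanded — none of index `0`). [folklore] -/
theorem stopsM_of_stops_succ {R : ℕ → ℕ} {Rm : ℕ → ℕ → ℕ} {t : ℕ} {E : Finset (Pt d)} {k : ℕ}
    (hdom : Rm t (k + 1) ≤ R (t + 1)) (h : Stops L s R (t + 1) (Sop (ratio L s t) E) k) :
    StopsM L s Rm t E (k + 1) := by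
  obtain ⟨hk, hI, hN, hall⟩ := h
  refine ⟨Nat.succ_pos k, ?_, ?_, fun l hl hlk => ?_⟩
  · rw [← orbit_succ_Sop]; exact hI
  · exact hdom.trans (hN.trans (Nat.le_succ k))
  · obtain ⟨l', rfl⟩ : ∃ l', l = l' + 1 := ⟨l - 1, by omega⟩
    refine ⟨trivial, ?_⟩
    rw [← orbit_succ_Sop]
    exact (hall l' (by omega) (by omega)).2

/-- the contrapositive, in the form the pendency clauses use [folklore] -/
theorem not_stops_succ_of_not_stopsM {R : ℕ → ℕ} {Rm : ℕ → ℕ → ℕ} {t : ℕ} {E : Finset (Pt d)} {k : ℕ}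
    (hdom : Rm t (k + 1) ≤ R (t + 1)) (h : ¬ StopsM L s Rm t E (k + 1)) :
    ¬ Stops L s R (t + 1) (Sop (ratio L s t) E) k :=
  fun hs => h (stopsM_of_stops_succ hdom hs)

/-- an `Rm`-stop at the relative index `k` needs `Rm t k ≤ k`; with `2 ≤ Rm t 1` there is none at index `1`, so a stop
at `j − t` with `t < j` has `t + 1 < j` … [folklore] -/
theorem succ_lt_of_stopsM {Rm : ℕ → ℕ → ℕ} (h2 : ∀ t, 2 ≤ Rm t 1) {t j : ℕ} {E : Finset (Pt d)}
    (h : StopsM L s Rm t E (j - t)) : t + 1 < j := by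
  have hpos := h.pos
  have hle := h.le
  by_contra hc
  have hj : j - t = 1 := by omega
  rw [hj] at hle
  have := h2 t
  omega

/-- … and condition (i) at the readiness index transports to the later event [folklore] -/
theorem condI_shift {t j : ℕ} (htj : t + 1 ≤ j) {E : Finset (Pt d)} (h : CondI 100 (orbit L s t E (j - t))) :
    CondI 100 (orbit L s (t + 1) (Sop (ratio L s t) E) (j - (t + 1))) := by
  rw [orbit_succ_Sop]
  have : j - (t + 1) + 1 = j - t := by omega
  rw [this]; exact h

end Shift

/-! ## §2 Genealogies in the dissolved bookkeeping: pseudo-components and fresh clusters -/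

/-- a splice whose replacements are nonempty ON THE LISTED PARTS does not shorten the list [folklore] -/
theorem length_le_length_splice_of {α β : Type*} {pV : α → List α} :
    ∀ l : List (α ⊕ β), (∀ p, Sum.inl p ∈ l → pV p ≠ []) → l.length ≤ (splice pV l).length
  | [], _ => le_rfl
  | Sum.inl p :: l, h => by
      rw [splice_cons_inl, List.length_append, List.length_map, List.length_cons]
      have h1 : 1 ≤ (pV p).length := List.length_pos_iff.2 (h p List.mem_cons_self)
      have ih := length_le_length_splice_of l fun q hq => h q (List.mem_cons_of_mem _ hq)
      omega
  | Sum.inr n :: l, h => by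
      rw [splice_cons_inr, List.length_cons, List.length_cons]
      exact Nat.succ_le_succ (length_le_length_splice_of l fun q hq => h q (List.mem_cons_of_mem _ hq))

namespace ComponentHistory

/-- the constituents-with-renewals list is as long as the constituent list [folklore] -/
theorem length_constituentsR_eq {γ : Type*} (H : ComponentHistory γ) (rnw : ℕ → γ → Bool) (rec : γ → PGen γ) (j : ℕ)
    (c : γ) : (H.constituentsR rnw rec j c).length = (H.constit (j + 1) c).length := by
  rw [constituentsR, List.length_map]

variable {H : ComponentHistory (Lab d)} {rnw : ℕ → Lab d → Bool} {dom : ℕ → Lab d → Finset (Pt d)} {L : ℕ} {s : ℕ → ℕ}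
  {spl : ℕ → Lab d → Lab d → List (Lab d)}

/-- `lonePartR` of a lone flagged part is `none` [folklore] -/
theorem lonePartR_singleton_inl_true {j : ℕ} {p : Lab d} (h : rnw j p = true) :
    lonePartR rnw j [Sum.inl p] = none := by
  simp [lonePartR, h]

/-- `lonePartR` of a lone unflagged part is that part [folklore] -/
theorem lonePartR_singleton_inl_false {j : ℕ} {p : Lab d} (h : rnw j p = false) :
    lonePartR rnw j [Sum.inl p] = some p := by
  simp [lonePartR, h]

/-- **A PSEUDO-COMPONENT'S GENEALOGY IS THE BIRTH OF ITS REGION** at its level. [folklore] -/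
theorem pgenR_dissolve_pseudo {j : ℕ} {n : Lab d} (hn : n ∈ H.pseudo j) :
    (H.dissolve spl).pgenR rnw j n = PGen.birth j (H.cls n) n := by
  cases j with
  | zero => exact (H.dissolve spl).pgenR_zero_birth rnw n n (H.constit_dissolve_pseudo spl hn)
  | succ j => exact (H.dissolve spl).pgenR_succ_birth rnw j n n (H.constit_dissolve_pseudo spl hn)

/-- its last-event domain is its region (when the domain map reads the regions) [folklore] -/
theorem edomR_dissolve_pseudo (hdom : ∀ j (n : Lab d), n ∈ H.newReg j → dom j n = n.2) (hW : H.WF) {j : ℕ} {n : Lab d}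
    (hn : n ∈ H.pseudo j) : edomR (H.dissolve spl) rnw dom j n = n.2 := by
  obtain ⟨c, hfc, hnc⟩ := H.mem_pseudo_iff.1 hn
  have hreg := hW.news_sub j c hfc.mem n hnc
  cases j with
  | zero => rw [edomR_zero, hdom 0 n hreg]
  | succ j =>
      rw [edomR_succ_event (H.dissolve spl) rnw dom (by rw [H.constit_dissolve_pseudo spl hn]; rfl), hdom _ n hreg]

/-- **A FRESH CLUSTER'S GENEALOGY HAS ITS LAST EVENT AT ITS OWN LEVEL** (a join of births). [folklore] -/
theorem lastStep_pgenR_fresh {j : ℕ} {p : Lab d} (hf : H.Fresh j p) : (H.pgenR rnw j p).lastStep = j := by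
  cases j with
  | zero =>
      rw [H.pgenR_zero_eq]
      exact lastStep_assembleR_of_two_le p 0 (by rw [length_births]; exact hf.two_le_news)
  | succ j =>
      rw [H.pgenR_succ_eq]
      refine lastStep_assembleR_of_two_le p (j + 1) ?_
      rw [length_constituentsR_eq]
      exact hf.two_le

/-- a fresh cluster's last-event domain is its domain [folklore] -/
theorem edomR_fresh {j : ℕ} {p : Lab d} (hf : H.Fresh j p) : edomR H rnw dom j p = dom j p := by
  cases j with
  | zero => rfl
  | succ j => exact edomR_succ_event H rnw dom (lonePartR_eq_none_of_two_le rnw j hf.two_le)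

/-! ## §3 The dichotomy of last steps and last-event domains -/

/-- **THE DICHOTOMY.**  Under `WF`, the admissible splice order, the label condition, «fresh clusters are never
flagged» and print's (G-flow) clause: for every REAL non-fresh component `x` of level `j`, EITHER the dissolved
genealogy has the same last step and last-event domain as print's, OR (the V-lines) its last step is one later —
still at most `j` — and its last-event domain is the first image of print's. [folklore] -/
theorem lastStep_edomR_dissolve (hW : H.WF) (hS : H.SpliceOK spl) (hL' : H.LabelOK)
    (hFr : ∀ j c, H.Fresh j c → rnw j c = false)
    (hF : ∀ j c p, c ∈ H.comp (j + 1) → H.constit (j + 1) c = [Sum.inl p] → dom (j + 1) c = Sop (ratio L s j) (dom j p)) :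
    ∀ (j : ℕ) (x : Lab d), x ∈ H.comp j → ¬ H.Fresh j x →
      ((H.dissolve spl).pgenR rnw j x).lastStep = (H.pgenR rnw j x).lastStep ∧
          edomR (H.dissolve spl) rnw dom j x = edomR H rnw dom j x ∨
        ((H.dissolve spl).pgenR rnw j x).lastStep = (H.pgenR rnw j x).lastStep + 1 ∧
          (H.pgenR rnw j x).lastStep + 1 ≤ j ∧
          edomR (H.dissolve spl) rnw dom j x = Sop (ratio L s (H.pgenR rnw j x).lastStep) (edomR H rnw dom j x) := by
  intro j
  induction j with
  | zero =>
      intro x hx hf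
      have hp : x ∉ H.pseudo 0 := not_mem_pseudo_of_mem_comp hL' hx
      left
      have hcs := H.constit_dissolve_zero spl hx hf hp
      constructor
      · rw [pgenR_zero_eq, pgenR_zero_eq]
        have : (H.dissolve spl).births 0 x = H.births 0 x := by
          simp only [births, news, hcs]; rfl
        rw [this]
      · rfl
  | succ j ih =>
      intro x hx hf
      have hp : x ∉ H.pseudo (j + 1) := not_mem_pseudo_of_mem_comp hL' hx
      have hcs := H.constit_dissolve_succ spl hx hf hp
      -- print's five cases on the constituent list
      match hl : H.constit (j + 1) x with
      | [] => exact absurd hl (hW.nonempty (j + 1) x hx)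
      | [Sum.inr n] =>
          left
          rw [hl, splice_singleton_inr] at hcs
          rw [H.pgenR_succ_birth rnw j x n hl, (H.dissolve spl).pgenR_succ_birth rnw j x n hcs,
            edomR_succ_event H rnw dom (by rw [hl]; rfl), edomR_succ_event (H.dissolve spl) rnw dom (by rw [hcs]; rfl)]
          exact ⟨rfl, rfl⟩
      | [Sum.inl p] =>
          have hpm : p ∈ H.parts (j + 1) x := (mem_lefts_iff p _).2 (by rw [hl]; simp)
          have hpc : p ∈ H.comp j := hW.parts_sub j x hx p hpm
          rw [hl, splice_singleton_inl] at hcs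
          by_cases hfp : H.Fresh j p
          · -- THE VIRTUAL MERGER: the fresh part is spliced into ≥ 2 pseudo-parts
            right
            rw [H.partV_of_fresh spl x hfp] at hcs
            have hflag := hFr j p hfp
            have h2 : 2 ≤ ((H.dissolve spl).constit (j + 1) x).length := by
              rw [hcs, List.length_map, (hS j x p hx hpm hfp).length_eq]; exact hfp.two_le_news
            have hlast' : ((H.dissolve spl).pgenR rnw (j + 1) x).lastStep = j + 1 := by
              rw [pgenR_succ_eq]
              refine lastStep_assembleR_of_two_le x (j + 1) ?_
              rw [length_constituentsR_eq]; exact h2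
            have hlast : (H.pgenR rnw (j + 1) x).lastStep = j := by
              rw [H.pgenR_succ_lone rnw j x p hl hflag]; exact lastStep_pgenR_fresh hfp
            refine ⟨by rw [hlast', hlast], by rw [hlast], ?_⟩
            rw [edomR_succ_event (H.dissolve spl) rnw dom (lonePartR_eq_none_of_two_le rnw j h2),
              edomR_succ_lone H rnw dom hl hflag, hlast, edomR_fresh hfp]
            exact hF j x p hx hl
          · rw [H.partV_of_not_fresh spl x hfp, List.map_singleton] at hcs
            cases hflag : rnw j p with
            | false =>
                -- no event on either side: inherited from `(j, p)`
                rw [H.pgenR_succ_lone rnw j x p hl hflag, (H.dissolve spl).pgenR_succ_lone rnw j x p hcs hflag,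
                  edomR_succ_lone H rnw dom hl hflag, edomR_succ_lone (H.dissolve spl) rnw dom hcs hflag]
                rcases ih p hpc hfp with h | ⟨h1, h2, h3⟩
                · exact Or.inl h
                · exact Or.inr ⟨h1, h2.trans (Nat.le_succ j), h3⟩
            | true =>
                -- a renewal on both sides
                left
                rw [H.pgenR_succ_renew rnw j x p hl hflag, (H.dissolve spl).pgenR_succ_renew rnw j x p hcs hflag,
                  edomR_succ_event H rnw dom (by rw [hl]; exact lonePartR_singleton_inl_true hflag),
                  edomR_succ_event (H.dissolve spl) rnw dom (by rw [hcs]; exact lonePartR_singleton_inl_true hflag)]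
                exact ⟨rfl, rfl⟩
      | y :: y' :: l =>
          -- an event (join) on both sides
          left
          have h2 : 2 ≤ (H.constit (j + 1) x).length := by rw [hl]; simp
          have h2' : 2 ≤ ((H.dissolve spl).constit (j + 1) x).length := by
            rw [H.constit_dissolve_succ spl hx hf hp]
            exact h2.trans (length_le_length_splice_of _ fun q hq => partV_ne_nil hS hx ((mem_lefts_iff q _).2 hq))
          rw [pgenR_succ_eq, pgenR_succ_eq, lastStep_assembleR_of_two_le x (j + 1)
              (by rw [length_constituentsR_eq]; exact h2'),
            lastStep_assembleR_of_two_le x (j + 1)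
              (by rw [length_constituentsR_eq]; exact h2),
            edomR_succ_event H rnw dom (lonePartR_eq_none_of_two_le rnw j h2),
            edomR_succ_event (H.dissolve spl) rnw dom (lonePartR_eq_none_of_two_le rnw j h2')]
          exact ⟨rfl, rfl⟩

end ComponentHistory

end

end Summit.QuantumFields.BalabanUV.T4Continuum.HistoryGenealogyExtraction
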